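import Mathlib
import HarnessLib

/-!
# ValiantsHypothesis / SymPencil — crux `SymmetrizePermPairs` (stmt-ValiantsHypothesis-17793),
# line `birth_SymmetrizePermPairs`, stub `stub_induce`, small-index regime, group step (C2):
# a small-index subgroup of `𝔖_n × 𝔖_n` contains `Alt(Ω∖X₁) × Alt(Ω∖X₂)`

Piece (C2) of the tenure's sizing of `stub_induce` (note `NOTE-p7g11-17793-stub_induce-sizing.md`,
cores (C1)–(C3) = the small-index regime `R < 2^{√(2 n log n)}`).  Pure group theory:

* Goursat fibres.  For `I ≤ G × G'` (finite groups) the fibre `N₁ = I.goursatFst = {g | (g,1) ∈ I}`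
  (Mathlib `Subgroup.goursatFst`) is normalised by the projection `K₁ = I.map fst`
  (`goursatFst_conj_mem`), `|I| ≤ |N₁| · |K₂|` (`card_le_card_goursatFst_mul`), hence
  `[G : N₁] ≤ [G × G' : I]` (`index_goursatFst_le`).
* DICHOTOMY (`le_goursatFst_of_index_lt_card`, and `…Snd…` by swapping the factors): a subgroup
  `A ≤ K₁` which is SIMPLE and has `|A| > [G × G' : I]` lies in `N₁`, i.e. `A × 1 ≤ I` — because
  `A ∩ N₁ ⊴ A` is `A` or trivial, and in the trivial case `A` embeds into `G ⧸ N₁`.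
* The even pointwise stabiliser `A_X = Alt(α ∖ X) ≤ Perm α` (the OUTPUT shape of the tree's
  Dixon–Mortimer 5.2B `alternating_fixing_le_of_index_lt_choose`), spelled
  `(alternatingGroup {x // x ∉ X}).map Perm.ofSubtype`: membership (`mem_altFixing_iff`), simplicity
  for `|α| − |X| ≥ 5` (Mathlib `alternatingGroup.isSimpleGroup`, `isSimpleGroup_altFixing`) and order
  `(|α| − |X|)!/2` (`two_mul_card_altFixing`).
* The ASSEMBLY with (C1) = Dixon–Mortimer 5.2B for both projections (`[ : K_i] ∣ [ : I]`,
  `Subgroup.index_map_dvd`; for `8 < |α|`, `1 ≤ k`, `4k ≤ |α|`, `[ : I] < C(|α|, k)`,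
  `2·[ : I] < (|α| − k)!` one gets `X₁, X₂` with `|X_i| < k` and `Alt(α∖X₁) × Alt(α∖X₂) ≤ I` via
  `Subgroup.goursatFst_prod_goursatSnd_le`) is the (C1) seat's file (merged-desk RULING #163 (b))
  and is deliberately NOT in this one.

Honest framing: helper layer for an OPEN stub (`stub_induce`) of an OPEN crux; the representation-
theoretic cores ((C2′) two-degree permify, (C3) equivariant GKKP) are untouched; `VP ≠ VNP` is NOT
proved and nothing here is progress on it.  No new definitions, no named facts
(`--supports stmt-ValiantsHypothesis-17793 --as helper`).
-/

-- `Summit.ValiantsHypothesis.ValiantsHypothesis.…` is the tree's mandated single-conjunct layout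
-- (Sub = Summit), so the duplicated namespace component is intended.
set_option linter.dupNamespace false

namespace Summit.ValiantsHypothesis.ValiantsHypothesis.Theorems.SymPencilEquivariantSdcNotQP.SmallIndex

open Equiv Equiv.Perm

/-! ### Goursat fibres of a subgroup of a product -/

section Goursat

variable {G G' : Type*} [Group G] [Group G']

/-- The fibre `N₁ = {g | (g, 1) ∈ I}` is normalised by the first projection of `I`. [folklore] -/
theorem goursatFst_conj_mem (I : Subgroup (G × G')) {k n : G}
    (hk : k ∈ I.map (MonoidHom.fst G G')) (hn : n ∈ I.goursatFst) :
    k * n * k⁻¹ ∈ I.goursatFst := by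
  rw [Subgroup.mem_goursatFst] at hn ⊢
  obtain ⟨x, hxI, hxk⟩ := Subgroup.mem_map.mp hk
  have hx : x = (k, x.2) := Prod.ext (by simpa using hxk) rfl
  have h := I.mul_mem (I.mul_mem hxI hn) (I.inv_mem hxI)
  have h2 : (k, x.2) * (n, 1) * (k, x.2)⁻¹ = (k * n * k⁻¹, 1) := by
    simp only [Prod.inv_mk, Prod.mk_mul_mk, mul_one, mul_inv_cancel]
  rw [hx, h2] at h
  exact h

/-- The fibre `N₂ = {h | (1, h) ∈ I}` is normalised by the second projection of `I`. [folklore] -/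
theorem goursatSnd_conj_mem (I : Subgroup (G × G')) {k n : G'}
    (hk : k ∈ I.map (MonoidHom.snd G G')) (hn : n ∈ I.goursatSnd) :
    k * n * k⁻¹ ∈ I.goursatSnd := by
  rw [Subgroup.mem_goursatSnd] at hn ⊢
  obtain ⟨x, hxI, hxk⟩ := Subgroup.mem_map.mp hk
  have hx : x = (x.1, k) := Prod.ext rfl (by simpa using hxk)
  have h := I.mul_mem (I.mul_mem hxI hn) (I.inv_mem hxI)
  have h2 : (x.1, k) * (1, n) * (x.1, k)⁻¹ = (1, k * n * k⁻¹) := by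
    simp only [Prod.inv_mk, Prod.mk_mul_mk, mul_one, mul_inv_cancel]
  rw [hx, h2] at h
  exact h

/-- `|I| ≤ |N₁| · |K₂|`: `I` fibres over its second projection with fibre the kernel `≅ N₁`.
[folklore] -/
theorem card_le_card_goursatFst_mul [Finite G] [Finite G'] (I : Subgroup (G × G')) :
    Nat.card I ≤ Nat.card I.goursatFst * Nat.card (I.map (MonoidHom.snd G G')) := by
  classical
  let s : I →* G' := (MonoidHom.snd G G').comp I.subtype
  have hrange : s.range = I.map (MonoidHom.snd G G') := by
    rw [MonoidHom.range_comp, Subgroup.range_subtype]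
  have hcard : Nat.card I = Nat.card s.range * Nat.card s.ker := by
    rw [← Subgroup.index_ker, Subgroup.index_mul_card]
  have hker : ∀ x : I, x ∈ s.ker → ((x : G × G')).2 = 1 := fun x hx => by
    simpa [s, MonoidHom.mem_ker] using hx
  let ψ : s.ker → I.goursatFst := fun x => ⟨((x : I) : G × G').1, by
    rw [Subgroup.mem_goursatFst]
    have h1 : (((x : I) : G × G').1, (1 : G')) = ((x : I) : G × G') := by
      rw [← hker x x.2]
    rw [h1]
    exact (x : I).2⟩
  have hψ : Function.Injective ψ := by
    intro x y h
    have h1 : ((x : I) : G × G').1 = ((y : I) : G × G').1 := by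
      have h' := congrArg Subtype.val h
      exact h'
    apply Subtype.ext
    apply Subtype.ext
    exact Prod.ext h1 ((hker x x.2).trans (hker y y.2).symm)
  calc Nat.card I = Nat.card s.range * Nat.card s.ker := hcard
    _ ≤ Nat.card s.range * Nat.card I.goursatFst :=
        Nat.mul_le_mul_left _ (Nat.card_le_card_of_injective ψ hψ)
    _ = Nat.card I.goursatFst * Nat.card (I.map (MonoidHom.snd G G')) := by rw [hrange, mul_comm]

/-- `[G : N₁] ≤ [G × G' : I]`. [folklore] -/
theorem index_goursatFst_le [Finite G] [Finite G'] (I : Subgroup (G × G')) :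
    I.goursatFst.index ≤ I.index := by
  have h1 : I.goursatFst.index * Nat.card I.goursatFst = Nat.card G := Subgroup.index_mul_card _
  have h2 : I.index * Nat.card I = Nat.card (G × G') := Subgroup.index_mul_card _
  have h3 := card_le_card_goursatFst_mul I
  have h4 : Nat.card (I.map (MonoidHom.snd G G')) ≤ Nat.card G' := Subgroup.card_le_card_group _
  have hI : 0 < Nat.card I := Nat.card_pos
  refine Nat.le_of_mul_le_mul_right ?_ hI
  calc I.goursatFst.index * Nat.card I
      ≤ I.goursatFst.index * (Nat.card I.goursatFst * Nat.card (I.map (MonoidHom.snd G G'))) :=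
        Nat.mul_le_mul_left _ h3
    _ = Nat.card G * Nat.card (I.map (MonoidHom.snd G G')) := by rw [← mul_assoc, h1]
    _ ≤ Nat.card G * Nat.card G' := Nat.mul_le_mul_left _ h4
    _ = I.index * Nat.card I := by rw [h2, Nat.card_prod]

/-- **Dichotomy, first factor.**  A SIMPLE subgroup `A` of the first projection of `I ≤ G × G'`
with `|A| > [G × G' : I]` lies in the fibre `N₁`, i.e. `A × 1 ≤ I`: `A ∩ N₁ ⊴ A` is `A` or
trivial, and if trivial `A ↪ G ⧸ N₁`, `|A| ≤ [G : N₁] ≤ [G × G' : I]`. [folklore] -/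
theorem le_goursatFst_of_index_lt_card [Finite G] [Finite G'] (I : Subgroup (G × G'))
    (A : Subgroup G) (hA : A ≤ I.map (MonoidHom.fst G G')) (hsimple : IsSimpleGroup A)
    (hlt : I.index < Nat.card A) : A ≤ I.goursatFst := by
  classical
  set M : Subgroup A := I.goursatFst.subgroupOf A with hM
  have hMn : M.Normal := by
    refine ⟨fun x hx a => ?_⟩
    rw [hM, Subgroup.mem_subgroupOf] at hx ⊢
    rw [Subgroup.coe_mul, Subgroup.coe_mul, Subgroup.coe_inv]
    exact goursatFst_conj_mem I (hA a.2) hx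
  rcases hsimple.eq_bot_or_eq_top_of_normal M hMn with hbot | htop
  · exfalso
    have hinj : Function.Injective (fun a : A => ((a : G) : G ⧸ I.goursatFst)) := by
      intro a b hab
      have h := QuotientGroup.eq.mp hab
      have hmem : a⁻¹ * b ∈ M := by
        rw [hM, Subgroup.mem_subgroupOf, Subgroup.coe_mul, Subgroup.coe_inv]
        exact h
      rw [hbot, Subgroup.mem_bot] at hmem
      exact inv_mul_eq_one.mp hmem
    have hle : Nat.card A ≤ I.goursatFst.index := Nat.card_le_card_of_injective _ hinj
    exact absurd (hle.trans (index_goursatFst_le I)) (not_le.mpr hlt)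
  · intro a ha
    have h : (⟨a, ha⟩ : A) ∈ M := by rw [htop]; exact Subgroup.mem_top _
    rw [hM, Subgroup.mem_subgroupOf] at h
    exact h

/-- **Dichotomy, second factor** (from the first by swapping the factors, `MulEquiv.prodComm`).
[folklore] -/
theorem le_goursatSnd_of_index_lt_card [Finite G] [Finite G'] (I : Subgroup (G × G'))
    (B : Subgroup G') (hB : B ≤ I.map (MonoidHom.snd G G')) (hsimple : IsSimpleGroup B)
    (hlt : I.index < Nat.card B) : B ≤ I.goursatSnd := by
  let e : G × G' ≃* G' × G := MulEquiv.prodComm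
  let I' : Subgroup (G' × G) := I.map (e : G × G' →* G' × G)
  have he : ∀ y : G × G', (e : G × G' →* G' × G) y = y.swap := fun y => rfl
  have hmem : ∀ x : G' × G, x ∈ I' ↔ x.swap ∈ I := by
    intro x
    constructor
    · rintro ⟨y, hy, rfl⟩
      rw [he, Prod.swap_swap]
      exact hy
    · intro hx
      exact ⟨x.swap, hx, by rw [he, Prod.swap_swap]⟩
  have h1 : I'.goursatFst = I.goursatSnd := by
    ext h
    rw [Subgroup.mem_goursatFst, Subgroup.mem_goursatSnd, hmem]
    rfl
  have h2 : I.map (MonoidHom.snd G G') ≤ I'.map (MonoidHom.fst G' G) := by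
    rintro h ⟨x, hx, rfl⟩
    refine ⟨e x, (hmem _).mpr ?_, rfl⟩
    change (x.swap).swap ∈ I
    rw [Prod.swap_swap]
    exact hx
  have h3 : I'.index = I.index := Subgroup.index_map_equiv I e
  rw [← h1]
  exact le_goursatFst_of_index_lt_card I' B (hB.trans h2) hsimple (by rw [h3]; exact hlt)

end Goursat

/-! ### The even pointwise stabiliser `Alt(α ∖ X) ≤ Perm α` -/

section Perm

variable {α : Type*} [Fintype α] [DecidableEq α]

/-- Membership in `Alt(α ∖ X)`: the image of `alternatingGroup {x // x ∉ X}` under `Perm.ofSubtype`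
consists exactly of the even permutations fixing `X` pointwise — the shape in which the tree's
Dixon–Mortimer 5.2B (`alternating_fixing_le_of_index_lt_choose`) is stated. [folklore] -/
theorem mem_altFixing_iff (X : Finset α) (ρ : Perm α) :
    ρ ∈ (alternatingGroup {x // x ∉ X}).map
        (Equiv.Perm.ofSubtype : Perm {x // x ∉ X} →* Perm α) ↔
      (∀ x ∈ X, ρ x = x) ∧ Equiv.Perm.sign ρ = 1 := by
  constructor
  · rintro ⟨f, hf, rfl⟩
    refine ⟨fun x hx => Equiv.Perm.ofSubtype_apply_of_not_mem f (fun h => h hx), ?_⟩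
    rw [Equiv.Perm.sign_ofSubtype]
    exact Equiv.Perm.mem_alternatingGroup.mp hf
  · rintro ⟨hfix, hsign⟩
    have h₁ : ∀ x, ρ x ∉ X ↔ x ∉ X := by
      intro x
      constructor
      · intro h hx
        exact h (by rwa [hfix x hx])
      · intro h hx
        have h3 : ρ x = x := ρ.injective (hfix _ hx)
        rw [h3] at hx
        exact h hx
    have h₂ : ∀ x, ρ x ≠ x → x ∉ X := fun x hx hxX => hx (hfix x hxX)
    refine ⟨ρ.subtypePerm h₁, ?_, Equiv.Perm.ofSubtype_subtypePerm h₁ h₂⟩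
    have hmem : ρ.subtypePerm h₁ ∈ alternatingGroup {x // x ∉ X} := by
      rw [Equiv.Perm.mem_alternatingGroup, ← Equiv.Perm.sign_ofSubtype,
        Equiv.Perm.ofSubtype_subtypePerm h₁ h₂]
      exact hsign
    exact hmem

/-- The complement of `X` has `|α| − |X|` elements. [folklore] -/
theorem card_notMem (X : Finset α) : Nat.card {x // x ∉ X} = Fintype.card α - X.card := by
  rw [Nat.card_eq_fintype_card, Fintype.card_subtype_compl, Fintype.card_coe]

/-- `Alt(α ∖ X)` is simple as soon as `|α| − |X| ≥ 5` (Mathlib `alternatingGroup.isSimpleGroup`,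
transported along `Perm.ofSubtype`). [folklore] -/
theorem isSimpleGroup_altFixing (X : Finset α) (h5 : 5 ≤ Fintype.card α - X.card) :
    IsSimpleGroup ↥((alternatingGroup {x // x ∉ X}).map
      (Equiv.Perm.ofSubtype : Perm {x // x ∉ X} →* Perm α)) := by
  haveI : IsSimpleGroup (alternatingGroup {x // x ∉ X}) :=
    alternatingGroup.isSimpleGroup (by rw [card_notMem]; exact h5)
  exact MulEquiv.isSimpleGroup
    ((alternatingGroup {x // x ∉ X}).equivMapOfInjective
      (Equiv.Perm.ofSubtype : Perm {x // x ∉ X} →* Perm α) Equiv.Perm.ofSubtype_injective).symm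

/-- `|Alt(α ∖ X)| = (|α| − |X|)!/2` (for `|α| − |X| ≥ 2`). [folklore] -/
theorem two_mul_card_altFixing (X : Finset α) (h2 : 2 ≤ Fintype.card α - X.card) :
    2 * Nat.card ↥((alternatingGroup {x // x ∉ X}).map
      (Equiv.Perm.ofSubtype : Perm {x // x ∉ X} →* Perm α)) =
      (Fintype.card α - X.card).factorial := by
  haveI : Nontrivial {x // x ∉ X} := by
    rw [← Fintype.one_lt_card_iff_nontrivial, ← Nat.card_eq_fintype_card, card_notMem]
    omega
  rw [Subgroup.card_map_of_injective Equiv.Perm.ofSubtype_injective,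
    two_mul_nat_card_alternatingGroup, Nat.card_perm, card_notMem]

end Perm

end Summit.ValiantsHypothesis.ValiantsHypothesis.Theorems.SymPencilEquivariantSdcNotQP.SmallIndex
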